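import Summits.BirchSwinnertonDyer.BirchSwinnertonDyer.Theorems.Rank2ObservatoryRank3RN3Certs1
import Summits.BirchSwinnertonDyer.BirchSwinnertonDyer.Theorems.Rank2ObservatoryRank3RN3Certs2
import Summits.BirchSwinnertonDyer.BirchSwinnertonDyer.Theorems.Rank2ObservatoryRank3RN3Certs3
import Summits.BirchSwinnertonDyer.BirchSwinnertonDyer.Theorems.Rank2ObservatoryRank3RN3Certs4
import Summits.BirchSwinnertonDyer.BirchSwinnertonDyer.Theorems.Rank2ObservatoryRank3RN3Certs5
import Summits.BirchSwinnertonDyer.BirchSwinnertonDyer.Theorems.Rank2ObservatoryRank3RootNumberCensus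
import HarnessLib

/-!
# BSD rank ≥ 2 observatory (`b2b-bsdr2`): THE ROOT NUMBER OF EVERY RANK-3 CENSUS CURVE, certified in
# the kernel modulo named local-root-number facts

HONEST FRAMING: per-curve certified theorems and census instruments; no claim on BSD in rank ≥ 2.

Census leaf of the root-number certificates WITH THE PLACE `3` (unit `b2b-bsdr2-cert-2`, gen 6).  The
gen-5 certificates `rank3RNCerts` (`Rank2ObservatoryRank3RootNumberCensus`) discharge
`hw : w(E) = −1` for the `7937` rows of the `9487`-row rank-3 census (`N < 5·10⁵`) that are NOT
additive at `3`, modulo the named fact `rootNumber_eq_neg_finprod_tableLocalRootNumberAt'`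
(Kellock–Dokchitser; hypothesis `hKD`).  The `1550` remaining rows — exactly the rows additive at `3`,
where that fact is guarded — are certified here by `RNCert3` certificates
(`Rank2ObservatoryRootNumberCert3`: the corrected `ℚ₂` table at `2`, Rizzo's Table II at `3`, split /
non-split / Rohrlich at `p ≥ 5`, all evaluated IN THE KERNEL, chunks `Rank2ObservatoryRank3RN3Certs1–5`)
modulo the named fact `rootNumber_eq_neg_finprod_fullTableLocalRootNumberAt` (Rizzo 2003 §1 + Table II;
hypothesis `hR`).

* `rank3RN3Certs` — the `1550` pairs `(row index, certificate)`; `rank3RN3Certs_length`; indices strictly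
  increasing (`rank3RN3Certs_sorted`) and all pointing at rows WITHOUT a gen-5 certificate
  (`rank3RN3Certs_uncovered`); `Rank3Row.certified3_of_mem_rn3Certs`.
* `coverWalk` / `mem_of_coverWalk` / `rank3_coverWalk` — one kernel pass over the aligned gen-5 list:
  EVERY row without a gen-5 certificate is listed here; `rank3_rootNumber_coverage`:
  `7937 + 1550 = 9487`.
* **`Rank3Row.rootNumber_eq_neg_one_of_mem`** — for EVERY row `r ∈ rank3Table`:
  `w(E_r) = −1` given the two named facts `hKD`, `hR` (each row uses one of them).
* Census headlines with `hw` REPLACED by the named facts on every row: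
  `Rank3Row.analyticRank_eq_rank_kernel_w` (`r_an = rank`, remaining hypotheses: Gross–Zagier–Kolyvagin,
  `rank ≤ 3`, `L‴(E,1) ≠ 0`, `hKD`, `hR`) and `Rank3Row.rank3_lderiv_eq_zero_kernel_wm` (`L′(E,1) = 0`
  over `K = ℚ(√D)`; `hmin` also gone by `Rank3Row.isGloballyMinimal_of_mem`).

What stays a hypothesis, by name: the two local-root-number table facts (`hKD`: [KellockDokchitser2023]
Thm. 2.3/§5 with Rohrlich; `hR`: [Rizzo2003] §1 Fact 3 + Table II with the published corrections
[Varillyalvarado2011] Rem. 4.2 = [BettinDavidDelaunay2018] §4), Gross–Zagier–Kolyvagin, `rank ≤ 3` /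
`L‴ ≠ 0` resp. the conductor value `hN` (discharged for the tame rows in
`Rank2ObservatoryRank3ConductorCensus`) and the analytic inputs of the `L′` theorem.  Cross-checks outside
the proofs: PARI/GP `ellrootno` global and local signs on all `9487` rows (jobs `j096884`, `j102193`), an
independent Python engine, and the compiled Lean evaluator on all `1550` certificates.
References: [Rizzo2003]; [KellockDokchitser2023]; [Rohrlich1993Compositio]; [CremonaAlgorithms1997] Tables;
[GrossLMS1991]; [Darmon2004].
-/

set_option linter.dupNamespace false
set_option autoImplicit false

open WeierstrassCurve Literature Literature.NumberTheory.EllipticCurves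

namespace Summit.BirchSwinnertonDyer.BirchSwinnertonDyer.Rank2Observatory

open RootNumber

/-- The `1550` root-number certificates with the place `3`: `(row index in rank3Table, certificate)`.
[cite: Rizzo2003, Table II (p. 4)] -/
def rank3RN3Certs : List (ℕ × RNCert3) :=
  rank3RN3Certs1 ++ rank3RN3Certs2 ++ rank3RN3Certs3 ++ rank3RN3Certs4 ++ rank3RN3Certs5

/-- `1550` certificates. [cite: CremonaAlgorithms1997, Tables] -/
theorem rank3RN3Certs_length : rank3RN3Certs.length = 1550 := by
  decide +kernel

/-- The listed row indices are strictly increasing (kernel): the `1550` rows are distinct. [folklore] -/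
theorem rank3RN3Certs_sorted : sortedLT (rank3RN3Certs.map Prod.fst) = true := by
  decide +kernel

/-- Every listed index points at a row WITHOUT a gen-5 certificate (`none` in `rank3RNCerts`; kernel):
the two certificate families are disjoint. [folklore] -/
theorem rank3RN3Certs_uncovered : posNone rank3RNCerts 0 (rank3RN3Certs.map Prod.fst) = true := by
  decide +kernel

/-- A listed index has no gen-5 certificate. [folklore] -/
theorem rank3RNCerts_eq_none_of_mem_rn3Certs {i : ℕ} {c : RNCert3} (hm : (i, c) ∈ rank3RN3Certs) :
    rank3RNCerts[i]? = some none := by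
  have h := isNone_of_posNone _ 0 _ rank3RN3Certs_uncovered i (List.mem_map.mpr ⟨(i, c), hm, rfl⟩)
  simpa using h.2

/-- **Every listed certificate checks on its row with certified product `+1`** (from the five kernel
chunk checks). [cite: Rizzo2003, §1 Fact 3 and Table II (p. 4)] -/
theorem check_of_mem_rn3Certs {i : ℕ} {c : RNCert3} (hm : (i, c) ∈ rank3RN3Certs) :
    ∃ hi : i < rank3Table.length, c.check (rank3Table[i]'hi).intModel = true ∧
      c.sign (rank3Table[i]'hi).intModel = 1 := by
  have H : ∀ {ps : List (ℕ × RNCert3)}, posCheck3 rank3Table 0 ps = true → (i, c) ∈ ps →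
      ∃ hi : i < rank3Table.length, c.check (rank3Table[i]'hi).intModel = true ∧
        c.sign (rank3Table[i]'hi).intModel = 1 := by
    intro ps h hm
    obtain ⟨-, r, hr, hc, hs⟩ := check_of_posCheck3 rank3Table 0 ps h i c hm
    rw [Nat.sub_zero] at hr
    obtain ⟨hi, rfl⟩ := List.getElem?_eq_some_iff.mp hr
    exact ⟨hi, hc, hs⟩
  simp only [rank3RN3Certs, List.mem_append] at hm
  rcases hm with (((h | h) | h) | h) | h
  · exact H rank3Table_rn3PosCheck1 h
  · exact H rank3Table_rn3PosCheck2 h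
  · exact H rank3Table_rn3PosCheck3 h
  · exact H rank3Table_rn3PosCheck4 h
  · exact H rank3Table_rn3PosCheck5 h

/-- **Every listed pair certifies its row.** [cite: Rizzo2003, §1 Fact 3 and Table II (p. 4)] -/
theorem Rank3Row.certified3_of_mem_rn3Certs {i : ℕ} {c : RNCert3} (hm : (i, c) ∈ rank3RN3Certs) :
    ∃ hi : i < rank3Table.length, (rank3Table[i]'hi).RootNumberCertified3 := by
  obtain ⟨hi, hc, hs⟩ := check_of_mem_rn3Certs hm
  exact ⟨hi, c, hc, hs⟩

/-- One-pass COVER check over an aligned option list: walking the list with a running index `n`, every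
`none` entry must be the head of the (increasing) index list `is`. [folklore] -/
def coverWalk : List (Option RNCert) → ℕ → List ℕ → Bool
  | [], _, _ => true
  | some _ :: os, n, is => coverWalk os (n + 1) is
  | none :: _, _, [] => false
  | none :: os, n, i :: is => decide (i = n) && coverWalk os (n + 1) is

/-- What a passing cover walk says: every `none` position (offset by `n`) is listed. [folklore] -/
theorem mem_of_coverWalk :
    ∀ (os : List (Option RNCert)) (n : ℕ) (is : List ℕ), coverWalk os n is = true →
      ∀ j : ℕ, os[j]? = some none → n + j ∈ is
  | [], _, _, _, j, hj => by simp at hj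
  | some _ :: os, n, is, h, j, hj => by
    cases j with
    | zero => simp at hj
    | succ j =>
      rw [List.getElem?_cons_succ] at hj
      have h' := mem_of_coverWalk os (n + 1) is (by simpa [coverWalk] using h) j hj
      rwa [show n + (j + 1) = n + 1 + j by omega]
  | none :: _, _, [], h, _, _ => by simp [coverWalk] at h
  | none :: os, n, i :: is, h, j, hj => by
    simp only [coverWalk, Bool.and_eq_true, decide_eq_true_eq] at h
    obtain ⟨hin, h⟩ := h
    subst hin
    cases j with
    | zero => simp
    | succ j =>
      rw [List.getElem?_cons_succ] at hj
      have h' := mem_of_coverWalk os (i + 1) is h j hj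
      exact List.mem_cons_of_mem _ (by rwa [show i + (j + 1) = i + 1 + j by omega])

/-- **COVER (kernel, one pass over the `9487` aligned gen-5 entries): every row without a gen-5
root-number certificate is listed in `rank3RN3Certs`.** [cite: CremonaAlgorithms1997, Tables] -/
theorem rank3_coverWalk : coverWalk rank3RNCerts 0 (rank3RN3Certs.map Prod.fst) = true := by
  decide +kernel

/-- Coverage count: `7937` gen-5 certificates + `1550` certificates with the place `3` = `9487` rows.
[cite: CremonaAlgorithms1997, Tables] -/
theorem rank3_rootNumber_coverage :
    rank3RNCerts.countP Option.isSome + rank3RN3Certs.length = rank3Table.length := by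
  rw [rank3RNCerts_count, rank3RN3Certs_length, rank3Table_length]

/-- **`w(E) = −1` FOR EVERY CURVE OF THE RANK-3 CENSUS, certified in the kernel modulo the named
local-root-number facts**: a row with a gen-5 certificate uses `hKD` (Kellock–Dokchitser's corrected
`ℚ₂` table + Rohrlich, guarded at `3`), a row additive at `3` uses `hR` (the same tables completed by
Rizzo's Table II at `3`). [cite: Rizzo2003, §1 Fact 3 and Table II (p. 4)]
[cite: KellockDokchitser2023, Thm. 2.3 and §5] -/
theorem Rank3Row.rootNumber_eq_neg_one_of_mem {r : Rank3Row} (hr : r ∈ rank3Table)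
    (hKD : r.curve.rootNumber_eq_neg_finprod_tableLocalRootNumberAt')
    (hR : r.curve.rootNumber_eq_neg_finprod_fullTableLocalRootNumberAt) : r.curve.rootNumber = -1 := by
  obtain ⟨i, hi, rfl⟩ := List.getElem_of_mem hr
  have hi' : i < rank3RNCerts.length := by
    rw [rank3RNCerts_length]; rw [rank3Table_length] at hi; exact hi
  rcases h : rank3RNCerts[i]'hi' with _ | c
  · have hmem : 0 + i ∈ rank3RN3Certs.map Prod.fst :=
      mem_of_coverWalk _ 0 _ rank3_coverWalk i (by rw [List.getElem?_eq_getElem hi', h])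
    rw [Nat.zero_add] at hmem
    obtain ⟨⟨i', c⟩, hm, hii⟩ := List.mem_map.mp hmem
    simp only at hii
    subst hii
    obtain ⟨hi2, hcert⟩ := Rank3Row.certified3_of_mem_rn3Certs hm
    exact Rank3Row.rootNumber_eq_neg_one_of_certified3 hcert hR
  · exact Rank3Row.rootNumber_eq_neg_one_of_certified
      (Rank3Row.rootNumberCertified_of_idx hi (by rw [List.getElem?_eq_getElem hi', h])) hKD

/-- **`r_an(E) = rank_ℤ E(ℚ) (= 3)` for EVERY row of the rank-3 census with `hlow` (gen 4) and `hw`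
(this file) discharged in the kernel**: remaining hypotheses Gross–Zagier–Kolyvagin, `rank ≤ 3`,
`L‴(E,1) ≠ 0` and the named local-root-number facts `hKD`, `hR`. [cite: Darmon2004, Thm. 3.22]
[cite: Rizzo2003, §1 Fact 3 and Table II (p. 4)] -/
theorem Rank3Row.analyticRank_eq_rank_kernel_w {r : Rank3Row} (hr : r ∈ rank3Table)
    (hGZK : rank_eq_analyticRank_of_analyticRank_le_one) (hup : r.curve.mordellWeilRank ≤ 3)
    (hL3 : iteratedDeriv 3 r.curve.entireLFunction 1 ≠ 0)
    (hKD : r.curve.rootNumber_eq_neg_finprod_tableLocalRootNumberAt')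
    (hR : r.curve.rootNumber_eq_neg_finprod_fullTableLocalRootNumberAt) :
    r.curve.analyticRank = r.curve.mordellWeilRank :=
  Rank3Row.analyticRank_eq_rank_kernel hr hGZK hup hL3 (Rank3Row.rootNumber_eq_neg_one_of_mem hr hKD hR)

/-- **`L′(E,1) = 0` over `K = ℚ(√D)` for EVERY row of the rank-3 census with `hlow`, `hw` AND `hmin`
discharged in the kernel** (`hmin`: `Rank3Row.isGloballyMinimal_of_mem`): remaining hypotheses the
analytic inputs, the conductor value `hN` and the named facts `hKD`, `hR`.
[cite: GrossLMS1991, (1.1) and Thm. 1.3] [cite: Rizzo2003, §1 Fact 3 and Table II (p. 4)] -/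
theorem Rank3Row.rank3_lderiv_eq_zero_kernel_wm {r : Rank3Row} (hr : r ∈ rank3Table) (K : Type)
    [Field K] [NumberField K] (hE : WeierstrassCurve.hasEntireLFunction_rat)
    (hGZKK : mordellWeilRank_eq_one_of_LDerivEK_ne_zero r.curve K)
    (hN : r.curve.conductorNorm ℤ = r.N) (hK : IsImaginaryQuadratic K) (hdK : NumberField.discr K = r.D)
    (hKD : r.curve.rootNumber_eq_neg_finprod_tableLocalRootNumberAt')
    (hR : r.curve.rootNumber_eq_neg_finprod_fullTableLocalRootNumberAt)
    (hLD : (r.curve.quadraticTwist (r.D : ℚ)).entireLFunction 1 ≠ 0) :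
    deriv r.curve.entireLFunction 1 = 0 :=
  Rank3Row.rank3_lderiv_eq_zero_kernel hr K hE hGZKK (Rank3Row.isGloballyMinimal_of_mem hr) hN hK hdK
    (Rank3Row.rootNumber_eq_neg_one_of_mem hr hKD hR) hLD

end Summit.BirchSwinnertonDyer.BirchSwinnertonDyer.Rank2Observatory
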